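import Summits.CriticalPhenomena.PercolationContinuityZ3.Theorems.PercNearOneGluingAdditiveGluingKnLemma3Mixed
import HarnessLib

/-! # Crux `PercNearOneGluing.AdditiveGluing` (stmt-CriticalPhenomena-4576), line `tieline` —
stub `stub_exchangeHas_c7`: the two-sided Kozma–Nitzan exchange given `o ∈ C(y)`

For the bond percolation measure `μ = prodBernoulli w` of a finite weighted graph on `Fin n` and
vertices `x, y, o, b`: if `μ(x ↔ b) ≤ μ(y ↔ b)` then
`μ(x ↔ b, x ↮ y, y ↔ o) ≤ μ(y ↔ b, x ↮ y, y ↔ o)` (Kozma–Nitzan, arXiv:2401.12397, Lemma 3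
(pp. 6–7), parts (i) and (ii) at once).

## Proof

The conditioning event `Q = {x ↮ y} ∩ {y ↔ o}` is a mixed-monotone function of the pair of open
edge clusters `(C_y, C_x)`: `{y ↔ o}` is increasing in `C_y` and `{x ↮ y}` is decreasing in `C_x`
(both read off the edge clusters via `reachable_iff_exists_mem_openEdgeCluster`).  Hence this is
the landed mixed form of Lemma 3, `knLemma3Mixed` (file `…AdditiveGluingKnLemma3Mixed.lean`, proved
from van den Berg–Häggström–Kahn 2006, Thm. 1.5, twice on `D = {y ↮ x}`), with `a₁ = x`, `a₂ = y`,
slack `d = 0`, after reassociating the intersection.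
-/

namespace Summit.CriticalPhenomena.PercolationContinuityZ3.Theorems

open MeasureTheory Set Literature.Probability.LatticeModels Literature.Probability.Percolation

noncomputable section
open Classical

/-- The event `{x ↮ y} ∩ {y ↔ o}` is mixed-monotone in the pair of open edge clusters
`(C_y, C_x)`: increasing in `C_y`, decreasing in `C_x`. [folklore] -/
theorem exchangeHas_mixedMonotone {n : ℕ} (x y o : Fin n) :
    ∀ ω ω' : BondConfig (Fin n), ω ∈ ((openConn x y)ᶜ ∩ openConn y o : Set (BondConfig (Fin n))) →
      openEdgeCluster ω y ⊆ openEdgeCluster ω' y → openEdgeCluster ω' x ⊆ openEdgeCluster ω x →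
      ω' ∈ ((openConn x y)ᶜ ∩ openConn y o : Set (BondConfig (Fin n))) := by
  rintro ω ω' ⟨hxy, hyo⟩ h2 h1
  refine ⟨fun hxy' => hxy ?_, ?_⟩
  · change (openGraph ω).Reachable x y
    rcases (reachable_iff_exists_mem_openEdgeCluster ω' x y).1 hxy' with rfl | ⟨e, he, hye⟩
    · exact SimpleGraph.Reachable.refl _
    · exact (reachable_iff_exists_mem_openEdgeCluster ω x _).2 (Or.inr ⟨e, h1 he, hye⟩)
  · change (openGraph ω').Reachable y o
    rcases (reachable_iff_exists_mem_openEdgeCluster ω y o).1 hyo with rfl | ⟨e, he, hoe⟩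
    · exact SimpleGraph.Reachable.refl _
    · exact (reachable_iff_exists_mem_openEdgeCluster ω' y _).2 (Or.inr ⟨e, h2 he, hoe⟩)

/-- **Two-sided Kozma–Nitzan exchange given `o ∈ C(y)`** (registered stub `stub_exchangeHas_c7` of
line `tieline`).  If `μ(x ↔ b) ≤ μ(y ↔ b)` for `μ = prodBernoulli w`, then
`μ(x ↔ b, x ↮ y, y ↔ o) ≤ μ(y ↔ b, x ↮ y, y ↔ o)`: the event `{x ↮ y} ∩ {y ↔ o}` is increasing in
the cluster of `y` and decreasing in the cluster of `x`, so the mixed form `knLemma3Mixed` of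
Lemma 3 (BHK 2006 Thm. 1.5 twice given `{x ↮ y}`) applies with `a₁ = x`, `a₂ = y`, `d = 0`.
[cite: KozmaNitzan2024, Lemma 3 (pp. 6–7)] [cite: VandenbergHaggstromKahn2005, Thm. 1.5 (p. 7)] -/
theorem stub_exchangeHas_c7 : ∀ (n : ℕ) (w : Sym2 (Fin n) → unitInterval) (x y o b : Fin n),
    (prodBernoulli w).real (openConn x b) ≤ (prodBernoulli w).real (openConn y b) →
    (prodBernoulli w).real (openConn x b ∩ (openConn x y)ᶜ ∩ openConn y o) ≤
      (prodBernoulli w).real (openConn y b ∩ (openConn x y)ᶜ ∩ openConn y o) := by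
  intro n w x y o b hle
  have key := knLemma3Mixed n w x y b ((openConn x y)ᶜ ∩ openConn y o) 0
    (exchangeHas_mixedMonotone x y o) le_rfl (by rw [add_zero]; exact hle)
  rw [add_zero, ← Set.inter_assoc, ← Set.inter_assoc] at key
  exact key

end

end Summit.CriticalPhenomena.PercolationContinuityZ3.Theorems
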